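/-
M15e (decomp-mm-lens-5 g28) — THE DEFLATION DIRECTION IS A TANGENT VECTOR OF THE FIBRE SCHEME;
systems with CONSTANT `F`-linear rows deflate by a CONSTANT field (the `I²` class of M15d is the
special case of zero rows).
-/
import Mathlib
import Summits.MatrixMultiplication.Statement
import Summits.MatrixMultiplication.MatrixMultiplication.Theorems.GraphEquationsForwardAD

/-!
# Graph equations — kernel fields are sections of the Zariski tangent spaces of the fibres

Supporting kernels for the crux `MultiplicityReduction` of route `GraphEquations`
(stub `BoundedOrderPurification`, rung `K = 2`; residual `UniformKernelFieldDeflation` of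
`GraphEquationsDeflation`).

For a test `t` of a system `E` write `Ψ⁻¹ t = Σ_q g_q(a,b)·F_q + O(F²)` (`liftF`).  The row
`g^{(t)} = (g_q)_q ∈ ℂ[A,B]^{n×n}` is the `C`-GRADIENT OF `t` ON THE GRAPH:
`g_q(y) = (∂t/∂c_q)(y, y_A y_B)` (`eval_graphPoint_pderiv_inr`), so the `C`-Jacobian
`E.jacobianC (graphPoint y)` of `GraphEquationsSystems` is the matrix of specialised rows, and its
kernel is the ZARISKI TANGENT SPACE at `c = y_A y_B` of the fibre scheme
`Z_y = {c : t(y,c) = 0 ∀ tests t}` (`EqSystem.jacobianC_graphPoint_mulVec_eq_zero_iff`).  A KERNEL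
FIELD (`D_μ t ∈ I` for all tests, `derivC_mem_graphIdeal_iff`) is exactly a polynomial section
`μ(a,b) ∈ ker J_C(graphPoint (a,b))` of this family of tangent spaces.

* `EqSystem.IdealInitIsolatedAt.deflate_tangent` — **the deflation direction can be taken TANGENT**:
  if `E` is correct and its test ideal is initially isolated to order `2` over `y`, there is
  `γ ∈ ker J_C(graphPoint y)` such that every system containing the `μ`-deflation of `E` for a
  field with `μ(y) = γ` has its test ideal initially isolated to order `1` over `y`.  (Proof: enlarge
  the isolating family by the tests themselves, declared at order `1` — their `F`-constant terms
  vanish because a correct system's tests lie on the graph — and apply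
  `InitIsolatedFam.deflate_of_data`, whose direction lies in the common kernel of ALL linear members.)
  So the value a kernel field must take at `y'` is a vector of the very space `ker J_C(graphPoint y')`
  of which the field is a section: `UniformKernelFieldDeflation` asks for a CHEAP section of
  `y ↦ ker J_C(graphPoint y)` with a generic value, nothing more.
* `EqSystem.derivC_const_mem_graphIdeal_of_constRows` — if the rows of `E` are CONSTANT
  (`coeff_{F_q} Ψ⁻¹t ∈ ℂ` for all tests and positions: generator tests `f_q`, Freivalds tests
  `xᵀ(C − AB)y` with constant `x, y`, anything in `I²`, and sums of such), a tangent vector at one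
  graph point, used as a CONSTANT coefficient field, is a kernel field.
* `exists_constField_deflation_of_constRows`, `exists_reduced_deflation_of_constRows` — hence such a
  system, if correct with test ideal initially isolated to order `2` over `y`, has a CORRECT
  deflation REDUCED at the graph point over `y` of cost `≤ 4·cost E + n²` (forward-mode AD of M15d
  with the constant program `constSystem γ`); `constRows_of_sq_tests` recovers the `I²` witness of
  `GraphEquationsForwardAD` as the zero-row case.  An impure example in the class:
  tests `{f₂₁, f₂₂, f₁₁ + f₁₂², f₁₂²}` (`n = 2`; correct, `C`-Jacobian of rank `3`, order `2`,
  rows `e₂₁, e₂₂, e₁₁, 0`; tangent space `ℂ·e₁₂`; the constant field `e₁₂` deflates it).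
-/

-- dupNamespace: forced by the nested Summit.MatrixMultiplication.MatrixMultiplication layout (D-0017)
set_option linter.dupNamespace false

noncomputable section

open scoped BigOperators

namespace Summit.MatrixMultiplication.MatrixMultiplication.Theorems.GraphEquations

open MvPolynomial Literature.Computability.AlgebraicComplexity
open Literature.Computability.AlgebraicComplexity.ArithCircuit

variable {n : ℕ}

/-! ## The `C`-gradient on the graph is the `F`-linear row -/

/-- **Row = gradient on the graph**: `(∂t/∂c_q)(y, y_A y_B) = (coeff_{F_q} Ψ⁻¹ t)(y)`. -/
theorem eval_graphPoint_pderiv_inr (y : MatMulVars n → ℂ) (q : Fin n × Fin n)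
    (t : MvPolynomial (GraphVars n) ℂ) :
    eval (graphPoint y) (pderiv (Sum.inr q) t) = eval y (coeff (Finsupp.single q 1) (liftF n t)) := by
  conv_lhs => rw [← substF_liftF t, ← substF_pderiv, eval_graphPoint_substF]
  rw [show constantCoeff (pderiv q (liftF n t)) = coeff 0 (pderiv q (liftF n t)) from rfl, coeff_pderiv]
  simp

/-- The specialised linear part of `Ψ⁻¹ t` at `y`, evaluated at `γ`, is the directional derivative
`Σ_q (∂t/∂c_q)(graphPoint y) · γ_q` of `t` at the graph point in the `C`-direction `γ`. -/
theorem eval_map_homogeneousComponent_one_liftF (y : MatMulVars n → ℂ) (γ : Fin n × Fin n → ℂ)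
    (t : MvPolynomial (GraphVars n) ℂ) :
    eval γ (map (eval y) (homogeneousComponent 1 (liftF n t))) =
      ∑ q, eval (graphPoint y) (pderiv (Sum.inr q) t) * γ q := by
  rw [eval_eq_sum_of_isHomogeneous_one ((homogeneousComponent_isHomogeneous 1 _).map (eval y))]
  refine Finset.sum_congr rfl fun q _ => ?_
  rw [coeff_map, coeff_homogeneousComponent, if_pos (by simp [Finsupp.degree]), eval_graphPoint_pderiv_inr]

/-- A test in `I²` has ZERO row: `coeff_{F_q} Ψ⁻¹ t = 0`. -/
theorem coeff_single_liftF_eq_zero_of_mem_sq {t : MvPolynomial (GraphVars n) ℂ}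
    (ht : t ∈ graphIdeal n ^ 2) (q : Fin n × Fin n) : coeff (Finsupp.single q 1) (liftF n t) = 0 := by
  classical
  have h := (derivC_mem_graphIdeal_iff (fun q' => if q' = q then 1 else 0) t).mp
    (derivC_mem_of_mem_sq _ ht)
  simpa using h

namespace EqSystem

/-- **`ker J_C(graphPoint y)` = the common kernel of the specialised rows** — the Zariski tangent
space at `c = y_A y_B` of the fibre scheme `{c : t(y, c) = 0 ∀ t}`. -/
theorem jacobianC_graphPoint_mulVec_eq_zero_iff (E : EqSystem n) (y : MatMulVars n → ℂ)
    (γ : Fin n × Fin n → ℂ) :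
    (E.jacobianC (graphPoint y)).mulVec γ = 0 ↔
      ∀ j ∈ E.tests, eval γ (map (eval y) (homogeneousComponent 1 (liftF n (E.testPoly j)))) = 0 := by
  constructor
  · intro h j hj
    obtain ⟨o, ho⟩ := List.mem_iff_get.mp hj
    have h' := congr_fun h o
    rw [eval_map_homogeneousComponent_one_liftF, ← ho]
    simpa [Matrix.mulVec, dotProduct, jacobianC] using h'
  · intro h
    funext o
    have h' := h _ (List.get_mem E.tests o)
    rw [eval_map_homogeneousComponent_one_liftF] at h'
    simpa [Matrix.mulVec, dotProduct, jacobianC] using h'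

/-- **THE DEFLATION DIRECTION IS TANGENT TO THE FIBRE.**  If `E` is correct and its test ideal is
initially isolated to order `2` over `y`, there is `γ ∈ ker J_C(graphPoint y)` such that for every
coefficient field `μ` with `μ(y) = γ`, every system containing the `μ`-deflation of `E` has its test
ideal initially isolated to order `1` over `y`.  (Sharpens `IdealInitIsolatedAt.deflate`.) -/
theorem IdealInitIsolatedAt.deflate_tangent {E : EqSystem n} {y : MatMulVars n → ℂ} (hE : E.Correct)
    (h : E.IdealInitIsolatedAt 2 y) :
    ∃ γ : Fin n × Fin n → ℂ, (E.jacobianC (graphPoint y)).mulVec γ = 0 ∧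
      ∀ μ : Fin n × Fin n → MvPolynomial (MatMulVars n) ℂ, (∀ q, eval y (μ q) = γ q) →
        ∀ E' : EqSystem n, E.DeflatesTo μ E' → E'.IdealInitIsolatedAt 1 y := by
  obtain ⟨T, u, hu, ν, G, hν, hG, hlow, hiso⟩ := h
  -- enlarge the family by the tests, declared at order `1`
  obtain ⟨v, hv⟩ : ∃ v : Fin E.tests.length → MvPolynomial (GraphVars n) ℂ,
      v = fun o => E.testPoly (E.tests.get o) := ⟨_, rfl⟩
  have hν' : ∀ o, Fin.append ν (fun _ : Fin E.tests.length => 1) o ≤ 2 := fun o => by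
    induction o using Fin.addCases with
    | left o => simpa only [Fin.append_left] using hν o
    | right o => simp only [Fin.append_right]; omega
  have hG' : ∀ o, substF n (Fin.append G (fun o => liftF n (v o)) o) = Fin.append u v o := fun o => by
    induction o using Fin.addCases with
    | left o => simp only [Fin.append_left, hG]
    | right o => simp only [Fin.append_right, substF_liftF]
  have hlow' : ∀ o, ∀ j < Fin.append ν (fun _ : Fin E.tests.length => 1) o,
      homogeneousComponent j (Fin.append G (fun o => liftF n (v o)) o) = 0 := fun o => by
    induction o using Fin.addCases with
    | left o => simpa only [Fin.append_left] using hlow o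
    | right o =>
      intro j hj
      simp only [Fin.append_right] at hj ⊢
      obtain rfl : j = 0 := by omega
      rw [hv]
      exact homogeneousComponent_zero_liftF_eq_zero fun x hx => hE.eval_testPoly_eq_zero hx (List.get_mem _ _)
  have hiso' : ∀ F₀ : Fin n × Fin n → ℂ,
      (∀ o, eval F₀ (map (eval y) (homogeneousComponent (Fin.append ν (fun _ : Fin E.tests.length => 1) o)
          (Fin.append G (fun o => liftF n (v o)) o))) =
        eval 0 (map (eval y) (homogeneousComponent (Fin.append ν (fun _ : Fin E.tests.length => 1) o)
          (Fin.append G (fun o => liftF n (v o)) o)))) → F₀ = 0 :=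
    fun F₀ hF => hiso F₀ fun o => by simpa only [Fin.append_left] using hF (Fin.castAdd _ o)
  obtain ⟨γ, hγN, hγ⟩ := InitIsolatedFam.deflate_of_data _ _ hν' hG' hlow' hiso'
  refine ⟨γ, (E.jacobianC_graphPoint_mulVec_eq_zero_iff y γ).mpr fun j hj => ?_, fun μ hμ E' hD => ?_⟩
  · obtain ⟨o, ho⟩ := List.mem_iff_get.mp hj
    have h := hγN (Fin.natAdd T o) (by simp only [Fin.append_right])
    rw [Fin.append_right, hv] at h
    simpa only [ho] using h
  · have hSS' : E.testSet ⊆ E'.testSet := fun t ht => by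
      obtain ⟨j, hj, rfl⟩ := (E.mem_testSet_iff t).mp ht
      obtain ⟨j', hj', hjj'⟩ := hD.1 j hj
      exact (E'.mem_testSet_iff _).mpr ⟨j', hj', hjj'⟩
    have hDS : ∀ t ∈ E.testSet, derivC μ t ∈ E'.testSet := fun t ht => by
      obtain ⟨j, hj, rfl⟩ := (E.mem_testSet_iff t).mp ht
      obtain ⟨j', hj', hjj'⟩ := hD.2 j hj
      exact (E'.mem_testSet_iff _).mpr ⟨j', hj', hjj'⟩
    have hmem : ∀ o, Fin.append u v o ∈ Ideal.span E.testSet := fun o => by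
      induction o using Fin.addCases with
      | left o => simp only [Fin.append_left]; exact hu o
      | right o => simp only [Fin.append_right, hv]; exact Ideal.subset_span ⟨o, rfl⟩
    refine (E'.idealInitIsolatedAt_iff 1 y).mpr ⟨_, _, fun i => ?_, hγ μ hμ⟩
    induction i using Fin.addCases with
    | left o => simp only [Fin.append_left]; exact Ideal.span_mono hSS' (hmem o)
    | right o => simp only [Fin.append_right]; exact derivC_mem_span μ hSS' hDS (hmem o)

/-- **CONSTANT ROWS ⇒ A TANGENT VECTOR IS A (CONSTANT) KERNEL FIELD.**  If every `coeff_{F_q} Ψ⁻¹ t`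
(`t` a test, `q` a position) is a constant, then for `γ ∈ ker J_C(graphPoint y)` the constant field
`μ = γ` satisfies `D_μ t ∈ I` for every test. -/
theorem derivC_const_mem_graphIdeal_of_constRows {E : EqSystem n}
    (hrows : ∀ j ∈ E.tests, ∀ q, ∃ c : ℂ, coeff (Finsupp.single q 1) (liftF n (E.testPoly j)) = C c)
    {y : MatMulVars n → ℂ} {γ : Fin n × Fin n → ℂ} (hγ : (E.jacobianC (graphPoint y)).mulVec γ = 0)
    {j : ℕ} (hj : j ∈ E.tests) : derivC (fun q => C (γ q)) (E.testPoly j) ∈ graphIdeal n := by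
  rw [derivC_mem_graphIdeal_iff]
  choose c hc using hrows j hj
  have h0 : ∑ q, eval (graphPoint y) (pderiv (Sum.inr q) (E.testPoly j)) * γ q = 0 := by
    have h := (E.jacobianC_graphPoint_mulVec_eq_zero_iff y γ).mp hγ j hj
    rwa [eval_map_homogeneousComponent_one_liftF] at h
  simp only [eval_graphPoint_pderiv_inr, hc, eval_C] at h0
  simp only [hc, ← C_mul, ← map_sum]
  rw [show ∑ q, γ q * c q = 0 by simpa only [mul_comm] using h0, C_0]

end EqSystem

/-- Tests in `I²` have constant (zero) rows. -/
theorem constRows_of_sq_tests {E : EqSystem n} (hsq : ∀ j ∈ E.tests, E.testPoly j ∈ graphIdeal n ^ 2) :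
    ∀ j ∈ E.tests, ∀ q, ∃ c : ℂ, coeff (Finsupp.single q 1) (liftF n (E.testPoly j)) = C c :=
  fun j hj q => ⟨0, by rw [coeff_single_liftF_eq_zero_of_mem_sq (hsq j hj), C_0]⟩

/-- **CONSTANT-FIELD DEFLATION ON THE CONSTANT-ROW CLASS.**  For a correct system with constant
rows whose test ideal is initially isolated to order `2` over `y`: the tangent deflation direction
`γ`, as a CONSTANT field, is computed by `constSystem γ` (cost `n²`), is a kernel field, and
deflates `E` to order `1` over the same `y`. -/
theorem exists_constField_deflation_of_constRows {E : EqSystem n} {y : MatMulVars n → ℂ}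
    (hE : E.Correct) (hiso : E.IdealInitIsolatedAt 2 y)
    (hrows : ∀ j ∈ E.tests, ∀ q, ∃ c : ℂ, coeff (Finsupp.single q 1) (liftF n (E.testPoly j)) = C c) :
    ∃ γ : Fin n × Fin n → ℂ,
      (∀ q, ∃ j ∈ (constSystem γ).tests, (constSystem γ).testPoly j = liftAB n (C (γ q))) ∧
      (∀ j ∈ E.tests, derivC (fun q => C (γ q)) (E.testPoly j) ∈ graphIdeal n) ∧
      (∀ E'' : EqSystem n, E.DeflatesTo (fun q => C (γ q)) E'' → E''.IdealInitIsolatedAt 1 y) := by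
  obtain ⟨γ, hγT, hγ⟩ := hiso.deflate_tangent hE
  refine ⟨γ, fun q => ⟨_, ?_, constSystem_testPoly γ q⟩,
    fun j hj => EqSystem.derivC_const_mem_graphIdeal_of_constRows hrows hγT hj,
    fun E'' hD => hγ _ (fun q => eval_C _) E'' hD⟩
  simp only [constSystem, List.mem_range]
  exact ((Fintype.equivFin (Fin n × Fin n)) q).isLt

/-- **WITNESS (constant-row class).**  A CORRECT system with constant rows whose test ideal is
initially isolated to order `2` over `y` has a CORRECT deflation REDUCED at the graph point over `y`,
of cost `≤ 4·cost E + n²`. -/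
theorem exists_reduced_deflation_of_constRows {E : EqSystem n} {y : MatMulVars n → ℂ} (hE : E.Correct)
    (hiso : E.IdealInitIsolatedAt 2 y)
    (hrows : ∀ j ∈ E.tests, ∀ q, ∃ c : ℂ, coeff (Finsupp.single q 1) (liftF n (E.testPoly j)) = C c) :
    ∃ E' : EqSystem n, E'.Correct ∧ E'.ReducedAt (graphPoint y) ∧ E'.cost ≤ 4 * E.cost + n * n := by
  obtain ⟨γ, hμ, hKF, hdefl⟩ := exists_constField_deflation_of_constRows hE hiso hrows
  obtain ⟨E', hfan, hD, hshape, hcost⟩ :=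
    forwardModeAD n E (constSystem γ) (fun q => C (γ q)) hE.1 (constSystem_isFanInTwo γ) hμ
  have hE' : E'.Correct := hE.of_deflatesTo hfan hD hshape hKF
  exact ⟨E', hE', EqSystem.reducedAt_of_idealInitIsolatedAt_one hE' (hdefl E' hD),
    (constSystem_cost γ) ▸ hcost⟩

/-- The tangent condition is also NECESSARY for a constant field on a constant-row system to be a
kernel field: `D_γ t ∈ I` for all tests forces `γ ∈ ker J_C(graphPoint y)` (for every `y`). -/
theorem EqSystem.jacobianC_mulVec_eq_zero_of_derivC_const_mem {E : EqSystem n} {γ : Fin n × Fin n → ℂ}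
    (hKF : ∀ j ∈ E.tests, derivC (fun q => C (γ q)) (E.testPoly j) ∈ graphIdeal n)
    (y : MatMulVars n → ℂ) : (E.jacobianC (graphPoint y)).mulVec γ = 0 := by
  refine (E.jacobianC_graphPoint_mulVec_eq_zero_iff y γ).mpr fun j hj => ?_
  have h := (derivC_mem_graphIdeal_iff _ _).mp (hKF j hj)
  rw [eval_map_homogeneousComponent_one_liftF]
  simp only [eval_graphPoint_pderiv_inr]
  have h' := congr_arg (eval y) h
  rw [map_sum, map_zero] at h'
  simpa only [map_mul, eval_C, mul_comm] using h'

end Summit.MatrixMultiplication.MatrixMultiplication.Theorems.GraphEquations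

end
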